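import Summits.CriticalPhenomena.PercolationContinuityZ3.Theorems.Transplant.AutChartCriticalContinuity
import HarnessLib

/-!
# The END-STATE input already carries a multi-type QUASI-STEP chart: an equivariant, Lipschitz chart `V → ℤ²` framed by finitely many types with
# quasi-steps `± N eᵢ` along walks of bounded length — no growth hypothesis (hypothesis side of any multi-type / quasi-step frames node)

builds on p205010 (kernel theorem, internal audit signed; external expert review pending) — nothing in this file uses p205010; UNCONDITIONAL, no node.
Lane `prim-bschramm`, seat `prim-bschramm-p4` gen 27 (PART C3 of `P4-GENERAL.md` §49.8).  Helper file (`--supports stmt-CriticalPhenomena-4575 --as helper`).  Def-free.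

THE POINT.  The END-STATE INPUT (a group `A` acting by automorphisms with FINITELY MANY orbits and a homomorphism `c : A → ℤ²` of rank-two image killing EVERY
vertex stabiliser — available on all of polynomial growth by `AutPoly.exists_finiteOrbits_rankTwo`, gen 27) gives AT ONCE, on any connected locally finite graph and
with NO growth hypothesis, the chart-and-frames data of a multi-type quasi-step interface (P4-GENERAL §41.5 (M)+(Q)), everything except the cylinder clause:
**`EndStateChart.exists_quasiChart`** — a chart `φ : V → ℤ²` with (i) `φ (a • w) = φ w + c(a)` (translated by the action), (ii) `|φ u i − φ v i| ≤ L` along edges,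
(iii) finitely many base vertices `B` (one per orbit) with FRAMES: every `w` is `α t` for some `t ∈ B` and an automorphism `α` translating `φ` by `φ w − φ t`, and
(iv) QUASI-STEPS: from every vertex, in each of the four directions `± N eᵢ` (one common `N ≥ 1`), a vertex at graph distance `≤ R` with chart EXACTLY `φ w ± N eᵢ`.
(Single-edge exact steps with a common `N` are NOT available for several types — gen 26's remark — which is why the end-state node needs quasi-steps.)  The cylinder
clause (κ′) needs bounded generation of `ker c`, i.e. the relative Milnor lemma on the `A`-orbit Rips graph off exponential growth (gen 25), and is not treated here.
PROOF.  One base vertex per orbit (`Quotient.out` of the orbit relation; finitely many since the orbits are); `φ w := c(a_w)` for any `a_w` carrying the base of `w`'s orbit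
to `w` — well defined up to the killed stabiliser, hence equivariant; `φ` vanishes on bases, so `φ v − φ u = φ(a_u⁻¹ • v)` is a chart value at a NEIGHBOUR of a base:
finitely many, whence Lipschitz; Cramer in `ℤ²` (`MaxArea.cramer`) writes `det · eᵢ` over two independent values, so some `gᵢ^± ∈ A` has `c = ± |det| eᵢ`; fixed walks
from each base `t` to `gᵢ^± • t`, translated by the frames, are the quasi-steps.
[cite: BenjaminiSchramm1996, §2 (almost transitive graphs); Conj. 4] [cite: KozmaNitzan2024, §4 p. 16 (Lemma 8: the role of the lattice symmetries)]
[cite: MartineauTassion2017, §3.2 (good coordinates)]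
-/

noncomputable section

namespace Summit.CriticalPhenomena.PercolationContinuityZ3.Theorems.Transplant

open SimpleGraph Literature.Barriers.CriticalPhenomena Literature.Probability.LatticeModels Literature.Probability.Percolation
open scoped Classical

namespace EndStateChart

variable {V : Type} {G : SimpleGraph V} [G.LocallyFinite] {A : Type} [Group A] [MulAction A V]

omit [G.LocallyFinite] in
/-- **Cramer in `ℤ²` for characters**: two values of independent determinant `D` give, for every direction `i` and sign `σ`, a group element whose character value
is EXACTLY `|D| σ eᵢ`. [cite: MartineauTassion2017, §3.2 (good coordinates)] -/
theorem exists_char_eq_single (c : A →* Multiplicative (Site 2)) (a b : A) (i : Fin 2) (σ : ℤˣ) :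
    ∃ g : A, Multiplicative.toAdd (c g) = Pi.single i ((|MaxArea.det2 (Multiplicative.toAdd (c a)) (Multiplicative.toAdd (c b))| : ℤ) * σ) := by
  set u := Multiplicative.toAdd (c a) with hu
  set v := Multiplicative.toAdd (c b) with hv
  set D := MaxArea.det2 u v with hDdef
  set e : Site 2 := Pi.single i 1 with he
  -- `D • e = det2 e v • u + det2 u e • v`
  set m : ℤ := MaxArea.det2 e v with hm
  set n : ℤ := MaxArea.det2 u e with hn
  have hcomb : D • e = m • u + n • v := by
    funext j
    simp only [Pi.smul_apply, Pi.add_apply, smul_eq_mul]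
    exact MaxArea.cramer u v e j
  set k : ℤ := (σ : ℤ) * Int.sign D with hk
  refine ⟨(a ^ m * b ^ n) ^ k, ?_⟩
  have h1 : Multiplicative.toAdd (c (a ^ m * b ^ n)) = D • e := by
    rw [map_mul, map_zpow, map_zpow, toAdd_mul, toAdd_zpow, toAdd_zpow, hcomb]
  rw [map_zpow, toAdd_zpow, h1, smul_smul]
  funext j
  rw [Pi.smul_apply, smul_eq_mul, he]
  by_cases hj : j = i
  · subst hj
    rw [Pi.single_eq_same, Pi.single_eq_same, mul_one, hk, mul_assoc, Int.sign_mul_self_eq_abs, mul_comm]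
  · rw [Pi.single_eq_of_ne hj, Pi.single_eq_of_ne hj, mul_zero]

/-- **THEOREM (unconditional, no growth hypothesis): the END-STATE input carries a multi-type quasi-step chart.**  `A` acting by automorphisms on a connected
locally finite `G` with finitely many orbits; `c : A → ℤ²` killing every vertex stabiliser, of rank-two image ⟹ a chart `φ : V → ℤ²` translated by `A`,
Lipschitz along edges, framed by finitely many base vertices through chart-translating automorphisms, with quasi-steps `± N eᵢ` within graph distance `R`.
[cite: BenjaminiSchramm1996, §2 (almost transitive graphs); Conj. 4] [cite: KozmaNitzan2024, §4 p. 16 (Lemma 8)] -/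
theorem exists_quasiChart (hact : IsActionByAut G A) (hc : G.Connected) (reps : Finset V) (hreps : ∀ w : V, ∃ a : A, ∃ s ∈ reps, a • s = w)
    (c : A →* Multiplicative (Site 2)) (hstab : ∀ (a : A) (w : V), a • w = w → c a = 1)
    (hrank : ∃ a b : A, MaxArea.det2 (Multiplicative.toAdd (c a)) (Multiplicative.toAdd (c b)) ≠ 0) :
    ∃ (φ : V → Site 2) (B : Finset V) (L N R : ℕ), 1 ≤ N ∧
      (∀ (a : A) (w : V), φ (a • w) = φ w + Multiplicative.toAdd (c a)) ∧
      (∀ ⦃u v : V⦄, G.Adj u v → ∀ i : Fin 2, |φ u i - φ v i| ≤ L) ∧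
      (∀ w : V, ∃ t ∈ B, ∃ α : G ≃g G, α t = w ∧ ∀ x, φ (α x) = φ x + (φ w - φ t)) ∧
      ∀ (w : V) (i : Fin 2) (σ : ℤˣ), ∃ w' : V, w' ∈ graphBall G w R ∧ φ w' = φ w + Pi.single i ((N : ℤ) * σ) := by
  -- one base vertex per orbit
  let base : V → V := fun w => (Quotient.mk (MulAction.orbitRel A V) w).out
  have hbase_orbit : ∀ w : V, ∃ a : A, a • base w = w := fun w => by
    have h : Quotient.mk (MulAction.orbitRel A V) (base w) = Quotient.mk (MulAction.orbitRel A V) w := Quotient.out_eq _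
    have h' : base w ∈ MulAction.orbit A w := MulAction.orbitRel_apply.1 (Quotient.exact h)
    obtain ⟨a, ha⟩ := MulAction.mem_orbit_iff.1 h'
    exact ⟨a⁻¹, by rw [← ha, inv_smul_smul]⟩
  have hbase_smul : ∀ (a : A) (w : V), base (a • w) = base w := fun a w => by
    show (Quotient.mk (MulAction.orbitRel A V) (a • w)).out = (Quotient.mk (MulAction.orbitRel A V) w).out
    congr 1
    exact Quotient.sound (MulAction.orbitRel_apply.2 (MulAction.mem_orbit _ _))
  choose sec hsec using hbase_orbit
  -- the chart
  let φ : V → Site 2 := fun w => Multiplicative.toAdd (c (sec w))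
  -- `c` is constant on the movers `base w ↦ w`
  have hc_mover : ∀ (w : V) (g : A), g • base w = w → Multiplicative.toAdd (c g) = φ w := fun w g hg => by
    have hst : (sec w)⁻¹ * g ∈ {x : A | x • base w = base w} := by
      show ((sec w)⁻¹ * g) • base w = base w
      rw [mul_smul, hg, inv_smul_eq_iff]
      exact (hsec w).symm
    have h1 : c ((sec w)⁻¹ * g) = 1 := hstab _ _ hst
    have h2 : c g = c (sec w) := by
      rw [map_mul, map_inv, inv_mul_eq_one] at h1
      exact h1.symm
    show Multiplicative.toAdd (c g) = Multiplicative.toAdd (c (sec w))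
    rw [h2]
  -- (i) equivariance
  have hequiv : ∀ (a : A) (w : V), φ (a • w) = φ w + Multiplicative.toAdd (c a) := fun a w => by
    have h := hc_mover (a • w) (a * sec w) (by rw [hbase_smul, mul_smul, hsec])
    rw [← h, map_mul, toAdd_mul, add_comm]
  -- `φ` vanishes on base vertices
  have hbase_base : ∀ w : V, base (base w) = base w := fun w => by
    show (Quotient.mk (MulAction.orbitRel A V) ((Quotient.mk (MulAction.orbitRel A V) w).out)).out = (Quotient.mk (MulAction.orbitRel A V) w).out
    rw [Quotient.out_eq]
  have hφ_base : ∀ w : V, φ (base w) = 0 := fun w => by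
    have h1 : sec (base w) • base w = base w := by have := hsec (base w); rwa [hbase_base] at this
    show Multiplicative.toAdd (c (sec (base w))) = 0
    rw [hstab _ _ h1, toAdd_one]
  have hφ_sec : ∀ w : V, φ w = Multiplicative.toAdd (c (sec w)) := fun w => rfl
  -- the finitely many base vertices
  set B : Finset V := reps.image base with hB
  have hbase_mem : ∀ w : V, base w ∈ B := fun w => by
    obtain ⟨a, s, hs, rfl⟩ := hreps w
    rw [hbase_smul]
    exact Finset.mem_image_of_mem base hs
  -- (ii) Lipschitz: `φ v − φ u` is the chart value at a NEIGHBOUR of a base vertex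
  set L : ℕ := B.sup fun t => (G.neighborFinset t).sup fun x => (Finset.univ : Finset (Fin 2)).sup fun i => (φ x i).natAbs with hL
  have hLip : ∀ ⦃u v : V⦄, G.Adj u v → ∀ i : Fin 2, |φ u i - φ v i| ≤ L := by
    intro u v huv i
    have h1 : (sec u)⁻¹ • u = base u := inv_smul_eq_iff.2 (hsec u).symm
    have hx : G.Adj (base u) ((sec u)⁻¹ • v) := by
      have h2 := (hact (sec u)⁻¹ u v).2 huv
      rwa [h1] at h2
    have hval : φ u - φ v = -φ ((sec u)⁻¹ • v) := by
      rw [hequiv, map_inv, toAdd_inv, hφ_sec u]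
      abel
    have hle : (φ ((sec u)⁻¹ • v) i).natAbs ≤ L :=
      (Finset.le_sup (f := fun i => (φ ((sec u)⁻¹ • v) i).natAbs) (Finset.mem_univ i)).trans
        ((Finset.le_sup (f := fun x => (Finset.univ : Finset (Fin 2)).sup fun i => (φ x i).natAbs) ((mem_neighborFinset _ _ _).2 hx)).trans
          (Finset.le_sup (f := fun t => (G.neighborFinset t).sup fun x => (Finset.univ : Finset (Fin 2)).sup fun i => (φ x i).natAbs)
            (hbase_mem u)))
    have hval_i : φ u i - φ v i = -φ ((sec u)⁻¹ • v) i := by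
      have := congrFun hval i
      rwa [Pi.sub_apply, Pi.neg_apply] at this
    rw [hval_i, abs_neg, Int.abs_eq_natAbs]
    exact_mod_cast hle
  -- (iii) frames through the base vertices
  have hframe : ∀ w : V, ∃ t ∈ B, ∃ α : G ≃g G, α t = w ∧ ∀ x, φ (α x) = φ x + (φ w - φ t) := fun w =>
    ⟨base w, hbase_mem w, smulIso hact (sec w), by rw [smulIso_apply]; exact hsec w, fun x => by
      rw [smulIso_apply, hequiv, hφ_base, sub_zero, hφ_sec w]⟩
  -- (iv) quasi-steps: Cramer gives `gᵢ^σ` with `c = |D| σ eᵢ`; fixed walks from the bases, translated by the frames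
  obtain ⟨a, b, hD⟩ := hrank
  set D : ℤ := MaxArea.det2 (Multiplicative.toAdd (c a)) (Multiplicative.toAdd (c b)) with hDdef
  choose g hg using fun q : Fin 2 × ℤˣ => exists_char_eq_single c a b q.1 q.2
  have hwk : ∀ (t : V) (q : Fin 2 × ℤˣ), ∃ wk : G.Walk t (g q • t), True := fun t q => by
    obtain ⟨wk⟩ := hc.preconnected t (g q • t); exact ⟨wk, trivial⟩
  choose wk _ using hwk
  set R : ℕ := B.sup fun t => (Finset.univ : Finset (Fin 2 × ℤˣ)).sup fun q => (wk t q).length with hR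
  refine ⟨φ, B, L, D.natAbs, R, Int.natAbs_pos.2 hD, hequiv, hLip, hframe, fun w i σ => ?_⟩
  set t : V := base w with ht
  refine ⟨sec w • g (i, σ) • t, ?_, ?_⟩
  · -- the translated walk
    have hstart : (smulIso hact (sec w)).toHom t = w := by show sec w • base w = w; exact hsec w
    refine ⟨((wk t (i, σ)).map (smulIso hact (sec w)).toHom).copy hstart rfl, ?_⟩
    rw [Walk.length_copy, Walk.length_map]
    exact (Finset.le_sup (f := fun q => (wk t q).length) (Finset.mem_univ (i, σ))).trans
      (Finset.le_sup (f := fun t => (Finset.univ : Finset (Fin 2 × ℤˣ)).sup fun q => (wk t q).length) (hbase_mem w))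
  · -- its chart value
    have hmv : (sec w * g (i, σ)) • base (sec w • g (i, σ) • t) = sec w • g (i, σ) • t := by
      rw [hbase_smul, hbase_smul, ht, hbase_base, mul_smul]
    rw [← hc_mover _ _ hmv, map_mul, toAdd_mul, hg, ← hφ_sec w, Int.natCast_natAbs]

end EndStateChart

end Summit.CriticalPhenomena.PercolationContinuityZ3.Theorems.Transplant

end
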